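import Literature.NumberTheory.Automorphic.UnitaryGroupSingularBracket
import Literature.NumberTheory.Automorphic.AdeleRingTopology
import HarnessLib

/-!
# Principal scalings and modules on the trace-zero adeles `𝔸_E⁻`: the lattice `E⁻` meets compacta finitely, principal
# `c`-fixed ideles permute `E⁻ ∖ 0` and have module `1`, `μY(λ⁻¹X) = χ⁻(λ)⁻¹ μY(X)`, `∫ G(λy + s) = χ⁻(λ)⁻¹ ∫ G`
(Weil, *Adeles and algebraic groups* (1982), Chap. I n° 12; Cassels–Fröhlich (1967), Ch. II §12–§14: discreteness of `E ≤ 𝔸_E`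
and the product formula)

Topic `NumberTheory/Automorphic`; namespace `Literature.NumberTheory.Automorphic.UnitaryGroup`. THEOREMS ONLY over accepted
tree modules (no definition, no named fact, no instance, no notation, no `sorry`). Plumbing brick (F6a-1) of the row (L5-iii-b2)
(b2-β) «`|b_T| ∈ L¹(Z B_γ(F)∖G(𝔸))` for every `T`» of the T1-qs LAW 5 road of `Cruxes/H413/Lines/F0_T1InnerFormTraceIdentity.lean`
(cell `pub/hodgecm-mathlib`, crux H413), consumed by the centre-line lattice-sum bounds `TraceZeroCentreLineLatticeSum` (F6a-2):
letters ★ `traceZeroAdele`, ★ `rationalTraceZero` (`E⁻`), ★ `smulTraceZero` ∕ ★ `traceZeroModulus` (`χ⁻`), ★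
`GaloisRepresentations.principalIdeles`.

* `finite_setOf_rationalTraceZero_mem` — `E⁻` meets every compact subset of `𝔸_E⁻` in finitely many points
  (★ `AdeleRing.discreteTopology_principalSubgroup`);
* `smulTraceZero_principal_mem_rationalTraceZero_iff`, `tsum_ne_zero_comp_smulTraceZero_principal` — a principal `c`-fixed
  idele `r = ι(ρ)` permutes `E⁻` and `E⁻ ∖ 0`; re-indexing of `Σ_{w ∈ E⁻∖0}`;
* `traceZeroModulus_mul` (Mathlib `addEquivAddHaarChar_trans`), `traceZeroModulus_eq_one_of_mem_principalIdeles` (★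
  `traceZeroModulus_eq_sqrt` + ★ `distribHaarChar_principalIdeles`), `measure_preimage_smulTraceZero_eq` (Mathlib
  `addEquivAddHaarChar_smul_preimage`), `integral_comp_smulTraceZero_add_eq` (★ `map_smulTraceZero_eq`).

## References
* A. Weil, *Adeles and algebraic groups* (1982), Chap. I n° 12 Lemme 5 [Weil1965].
* J. W. S. Cassels, A. Fröhlich (eds.), *Algebraic Number Theory* (1967), Ch. II §12 Theorem, §14 Theorem [CasselsFrohlichANT1967].
* J. D. Rogawski, *Automorphic Representations of Unitary Groups in Three Variables*, Ann. of Math. Stud. 123 (1990), §7.2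
  Prop. 7.2.1 (p. 95) [Rogawski1990].
-/

set_option autoImplicit false

noncomputable section

open MeasureTheory Measure NumberField IsDedekindDomain Set Topology
open Literature.MeasureTheory.Group
open scoped NNReal ENNReal Pointwise

namespace Literature.NumberTheory.Automorphic

namespace UnitaryGroup

variable {F E : Type} [Field F] [Field E] [NumberField E] [Algebra F E] {c : E ≃ₐ[F] E}

/-! ## §1 Plumbing: the lattice `E⁻`, principal scalings, modules -/

section Lattice

/-- **`E⁻` meets every compact subset of `𝔸_E⁻` in finitely many points** (`E ≤ 𝔸_E` is discrete and closed,
★ `AdeleRing.discreteTopology_principalSubgroup`). [cite: CasselsFrohlichANT1967, Ch. II §14 Theorem] -/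
theorem finite_setOf_rationalTraceZero_mem {K : Set (traceZeroAdele F E c)} (hK : IsCompact K) :
    {w : rationalTraceZero F E c | (w : traceZeroAdele F E c) ∈ K}.Finite := by
  haveI := t2Space_adeleRing_of_numberField E
  haveI := AdeleRing.discreteTopology_principalSubgroup E
  -- the compact image of `K` in `𝔸_E` meets the principal adeles in a finite set
  have hK' : IsCompact (((↑) : traceZeroAdele F E c → AdeleRing (𝓞 E) E) '' K) := hK.image continuous_subtype_val
  have hP : IsClosed (AdeleRing.principalSubgroup (𝓞 E) E : Set (AdeleRing (𝓞 E) E)) :=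
    AddSubgroup.isClosed_of_discrete
  have hfin : ((((↑) : traceZeroAdele F E c → AdeleRing (𝓞 E) E) '' K) ∩
      (AdeleRing.principalSubgroup (𝓞 E) E : Set (AdeleRing (𝓞 E) E))).Finite :=
    (hK'.inter_right hP).finite (isDiscrete_iff_discreteTopology.mpr
      (DiscreteTopology.of_subset ‹DiscreteTopology (AdeleRing.principalSubgroup (𝓞 E) E)› Set.inter_subset_right))
  -- pull back along the injection `w ↦ ↑↑w`
  have hinj : Set.InjOn (fun w : rationalTraceZero F E c => ((w : traceZeroAdele F E c) : AdeleRing (𝓞 E) E)) univ :=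
    fun a _ b _ h => Subtype.ext (Subtype.ext h)
  refine (hfin.preimage (hinj.mono (subset_univ _))).subset fun w hw => ?_
  obtain ⟨ξ, hξ⟩ := (mem_rationalTraceZero_iff _).1 w.2
  exact ⟨⟨(w : traceZeroAdele F E c), hw, rfl⟩, ⟨ξ, hξ⟩⟩

/-- Scaling by a principal idele preserves the lattice `E⁻`: for `r = ι(ρ)`, `ρ ∈ Eˣ`, `c`-fixed as an idele,
`r · y ∈ E⁻ ↔ y ∈ E⁻`. [cite: Rogawski1990, §7.2 (p. 95)] -/
theorem smulTraceZero_principal_mem_rationalTraceZero_iff {r : (AdeleRing (𝓞 E) E)ˣ}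
    (hr : conjAdele F E c (r : AdeleRing (𝓞 E) E) = r) (hrp : r ∈ GaloisRepresentations.principalIdeles E)
    (y : traceZeroAdele F E c) :
    smulTraceZero r hr y ∈ rationalTraceZero F E c ↔ y ∈ rationalTraceZero F E c := by
  obtain ⟨ρ, hρ⟩ := hrp
  have hrρ : (r : AdeleRing (𝓞 E) E) = algebraMap E (AdeleRing (𝓞 E) E) (ρ : E) := by
    rw [← hρ, Units.coe_map, MonoidHom.coe_coe]
  rw [mem_rationalTraceZero_iff, mem_rationalTraceZero_iff, coe_smulTraceZero, hrρ]
  constructor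
  · rintro ⟨η, hη⟩
    refine ⟨(ρ⁻¹ : Eˣ) * η, ?_⟩
    rw [map_mul, hη, ← mul_assoc, ← map_mul, Units.inv_mul, map_one, one_mul]
  · rintro ⟨ξ, hξ⟩
    exact ⟨ρ * ξ, by rw [map_mul, hξ]⟩

/-- **Re-indexing the lattice sum by a principal scaling**: `Σ_{w ∈ E⁻∖0} g(r w) = Σ_{w ∈ E⁻∖0} g(w)` for `r = ι(ρ)`,
`ρ ∈ Eˣ` (`w ↦ r w` permutes `E⁻ ∖ 0`). [cite: Rogawski1990, §7.2 (p. 95)] -/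
theorem tsum_ne_zero_comp_smulTraceZero_principal {V : Type*} [AddCommMonoid V] [TopologicalSpace V]
    {r : (AdeleRing (𝓞 E) E)ˣ} (hr : conjAdele F E c (r : AdeleRing (𝓞 E) E) = r)
    (hrp : r ∈ GaloisRepresentations.principalIdeles E) (g : traceZeroAdele F E c → V) :
    ∑' w : {w : rationalTraceZero F E c // w ≠ 0}, g (smulTraceZero r hr (w.1 : traceZeroAdele F E c)) =
      ∑' w : {w : rationalTraceZero F E c // w ≠ 0}, g (w.1 : traceZeroAdele F E c) := by
  -- the permutation of `E⁻ ∖ 0`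
  set e₀ : rationalTraceZero F E c ≃ rationalTraceZero F E c :=
    { toFun := fun w => ⟨smulTraceZero r hr w, (smulTraceZero_principal_mem_rationalTraceZero_iff hr hrp _).2 w.2⟩
      invFun := fun w => ⟨(smulTraceZero r hr).symm w, by
        rw [← smulTraceZero_principal_mem_rationalTraceZero_iff hr hrp, ContinuousAddEquiv.apply_symm_apply]; exact w.2⟩
      left_inv := fun w => Subtype.ext ((smulTraceZero r hr).symm_apply_apply _)
      right_inv := fun w => Subtype.ext ((smulTraceZero r hr).apply_symm_apply _) } with he₀
  have he₀0 : ∀ w : rationalTraceZero F E c, e₀ w = 0 ↔ w = 0 := fun w => by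
    constructor
    · intro h
      have h1 : smulTraceZero r hr (w : traceZeroAdele F E c) = 0 := by
        have := congrArg (fun z : rationalTraceZero F E c => (z : traceZeroAdele F E c)) h
        simpa [he₀] using this
      have h2 : (w : traceZeroAdele F E c) = 0 := by
        rw [← (smulTraceZero r hr).symm_apply_apply (w : traceZeroAdele F E c), h1, map_zero]
      exact Subtype.ext h2
    · rintro rfl
      refine Subtype.ext ?_
      change smulTraceZero r hr ((0 : rationalTraceZero F E c) : traceZeroAdele F E c) = _
      rw [ZeroMemClass.coe_zero, map_zero]
  set e : {w : rationalTraceZero F E c // w ≠ 0} ≃ {w : rationalTraceZero F E c // w ≠ 0} :=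
    e₀.subtypeEquiv fun w => by rw [Ne, Ne, he₀0] with he
  exact e.tsum_eq (fun w : {w : rationalTraceZero F E c // w ≠ 0} => g (w.1 : traceZeroAdele F E c))

variable [LocallyCompactSpace (AdeleRing (𝓞 E) E)] [MeasurableSpace (AdeleRing (𝓞 E) E)] [BorelSpace (AdeleRing (𝓞 E) E)]

/-- **The module is multiplicative**: `χ⁻(l l') = χ⁻(l) χ⁻(l')` (Mathlib `addEquivAddHaarChar_trans`). [cite: Weil1965, Chap. I n° 12] -/
theorem traceZeroModulus_mul (l l' : (AdeleRing (𝓞 E) E)ˣ) (hl : conjAdele F E c (l : AdeleRing (𝓞 E) E) = l)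
    (hl' : conjAdele F E c (l' : AdeleRing (𝓞 E) E) = l')
    (hll' : conjAdele F E c ((l * l' : (AdeleRing (𝓞 E) E)ˣ) : AdeleRing (𝓞 E) E) = (l * l' : (AdeleRing (𝓞 E) E)ˣ)) :
    traceZeroModulus (F := F) (c := c) (l * l') hll' = traceZeroModulus l hl * traceZeroModulus l' hl' := by
  haveI := locallyCompactSpace_traceZeroAdele (F := F) (E := E) (c := c)
  have he : smulTraceZero (F := F) (c := c) (l * l') hll' = (smulTraceZero l' hl').trans (smulTraceZero l hl) := by
    ext y
    change ((l * l' : (AdeleRing (𝓞 E) E)ˣ) : AdeleRing (𝓞 E) E) * y = l * (l' * y)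
    rw [Units.val_mul, mul_assoc]
  unfold traceZeroModulus
  rw [he, addEquivAddHaarChar_trans, mul_comm]

/-- **A principal `c`-fixed idele has module `1` on `𝔸_E⁻`** (product formula: `χ⁻(l)² = ‖l‖_{𝔸_E} = 1`).
[cite: Weil1965, Chap. I n° 12] [cite: CasselsFrohlichANT1967, Ch. II §12 Theorem (product formula)] -/
theorem traceZeroModulus_eq_one_of_mem_principalIdeles (hc : c * c = 1) (hc1 : c ≠ 1) {l : (AdeleRing (𝓞 E) E)ˣ}
    (hl : conjAdele F E c (l : AdeleRing (𝓞 E) E) = l) (hp : l ∈ GaloisRepresentations.principalIdeles E) :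
    traceZeroModulus l hl = 1 := by
  obtain ⟨δ, hδ⟩ := exists_conjAdele_eq_neg (F := F) (E := E) hc hc1
  rw [traceZeroModulus_eq_sqrt hc δ hδ l hl, AdeleRing.distribHaarChar_principalIdeles E hp, NNReal.sqrt_one]

variable (μY : Measure (traceZeroAdele F E c)) [μY.IsAddHaarMeasure]

/-- **`μY(λ⁻¹ X) = χ⁻(λ)⁻¹ μY(X)`** (Mathlib `addEquivAddHaarChar_smul_preimage`). [cite: Weil1965, Chap. I n° 12] -/
theorem measure_preimage_smulTraceZero_eq [μY.Regular] (l : (AdeleRing (𝓞 E) E)ˣ)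
    (hl : conjAdele F E c (l : AdeleRing (𝓞 E) E) = l) (X : Set (traceZeroAdele F E c)) :
    μY (smulTraceZero l hl ⁻¹' X) = ((traceZeroModulus l hl)⁻¹ : ℝ≥0) * μY X := by
  haveI := locallyCompactSpace_traceZeroAdele (F := F) (E := E) (c := c)
  have h := addEquivAddHaarChar_smul_preimage μY (X := X) (smulTraceZero l hl)
  have hpos := traceZeroModulus_pos (F := F) (E := E) (c := c) l hl
  rw [ENNReal.smul_def, smul_eq_mul] at h
  change (traceZeroModulus l hl : ℝ≥0∞) * μY (smulTraceZero l hl ⁻¹' X) = μY X at h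
  rw [← h, ← mul_assoc, ← ENNReal.coe_mul, inv_mul_cancel₀ hpos.ne', ENNReal.coe_one, one_mul]

/-- **`∫ G(λ y + s) dμY(y) = χ⁻(λ)⁻¹ • ∫ G dμY`** (★ `map_smulTraceZero_eq` and translation invariance).
[cite: Weil1965, Chap. I n° 12] -/
theorem integral_comp_smulTraceZero_add_eq [μY.Regular] (l : (AdeleRing (𝓞 E) E)ˣ)
    (hl : conjAdele F E c (l : AdeleRing (𝓞 E) E) = l) (s : traceZeroAdele F E c)
    {V : Type*} [NormedAddCommGroup V] [NormedSpace ℝ V] (G : traceZeroAdele F E c → V) :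
    ∫ y, G (smulTraceZero l hl y + s) ∂μY = ((traceZeroModulus l hl : ℝ≥0)⁻¹ : ℝ) • ∫ y, G y ∂μY := by
  have hme : MeasurableEmbedding (smulTraceZero l hl) := (smulTraceZero l hl).toHomeomorph.measurableEmbedding
  have h1 : ∫ y, G (smulTraceZero l hl y + s) ∂μY = ∫ y, (fun z => G (z + s)) y ∂(μY.map (smulTraceZero l hl)) :=
    (hme.integral_map (μ := μY) (fun z => G (z + s))).symm
  rw [h1, map_smulTraceZero_eq l hl μY, integral_smul_nnreal_measure, integral_add_right_eq_self (fun z => G z) s]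
  rfl

end Lattice

end UnitaryGroup

end Literature.NumberTheory.Automorphic

end
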